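import Summits.AtomisticToContinuum.HydrodynamicLimit.Theorems.CollisionIsometryCLTCollisionalTransferLocalityDefsE
import Literature.MathematicalPhysics.KineticTheory.EvenCollisionTubeFunctional
import HarnessLib

/-!
# Vocabulary of the line `hemisphere-affine-slaving`, part F: the TWO-SCALE ENGINE STATEMENT of the crux
(crux `CollisionalTransferLocality`, stmt-AtomisticToContinuum-9518; rank 3 of route `StiffCollisionalRelaxation`, rank 4 of `CollisionIsometryCLT`)

Definitions-only support file (`--supports stmt-AtomisticToContinuum-9518`) of the line lead (gen 1, seat c10), continuing `…Defs`–`…DefsE`. Seat c10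
docked the crux's momentum engine on the sibling crux `JParityClosure.EvenStressEnskog` (13079) by name (…MomentumEngineOfEvenStress / …StressLawFixedAOfEvenStress):
`EvenStressEnskog → TwoScaleValueRegularity → CollisionalStressLaw`. The one new research statement this leaves is the ONE-BODY two-scale statement [TS]
(registered stub `stub_twoScaleValueA` of the skeleton, signature verbatim = `TwoScaleValueRegularity` below). This file makes it NAMEABLE and FILEABLE:
* `TwoScaleValueRegularity : Prop` — [TS] in the line's vocabulary (…Defs/…DefsE names);
* `TwoScaleValueRegularityInline : Prop` — the same statement written with ONLY Mathlib/Literature names and `let`-telescopes, exactly as route items are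
  written (the value functional `V χ A N z τ = ∫₀^τ∫ [tr A · p_c(ρ̄, θ̄) + (2/5)(D̄:A)/(ρ̄θ̄) · p_c(ρ̄, θ̄)]` of the block fields of a kernel `χ`, compared
  for the FIXED cone kernel `b_r = coneKernel r · 0` and the mesoscale kernel `φ_N`);
* `twoScaleValueRegularity_iff_inline` — they are equivalent (definitional unfolding).
Content: for all nice profiles there are `σ₀, η₁ > 0` such that for `0 < σ < σ₀`, every flow family, `t > 0`, admissible kernel family with the dilute
event, smooth matrix weight `A` on `[0, t]`, `τ ≤ t`, `η, δ > 0`: for `r < r₀(…)` and `N ≥ N₀(r, …)`, `P(η < |V[b_r](τ) − V[φ_N](τ)|) ≤ δ` — the block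
fields do not oscillate between the mesoscale `(N+1)^{-γ}` and the macroscale `r` inside the nonlinear collisional-pressure functional. At constant
profiles it is a theorem of the line (`twoScaleValueA_rung0`, skeleton composition 5). Nothing in this file is asserted.
-/

namespace Summit.AtomisticToContinuum.HydrodynamicLimit.Theorems.HemisphereAffineSlaving

open scoped BigOperators Topology Classical ENNReal InnerProductSpace
open Filter Set Function MeasureTheory
open Literature.Analysis.FunctionSpaces

noncomputable section

open Literature.MathematicalPhysics.KineticTheory (T3 V3)

/-- **[TS] TWO-SCALE REGULARITY OF THE VALUE FUNCTIONAL** (registered research stub `stub_twoScaleValueA`, verbatim), in the line's vocabulary. -/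
def TwoScaleValueRegularity : Prop :=
  ∀ (a₀ θ₀ : T3 → ℝ) (u₀ : T3 → V3), NiceProfiles a₀ θ₀ u₀ → ∃ σ₀ : ℝ, 0 < σ₀ ∧ ∃ η₁ : ℝ, 0 < η₁ ∧ ∀ σ : ℝ, 0 < σ → σ < σ₀ → ∀ (Φ : Flows σ) (t : ℝ), 0 < t → ∀ (γ C : ℝ) (φ : ℕ → T3 → ℝ), 0 < γ → γ ≤ 1 / 15 → AdmissibleKernel γ C φ → DiluteAt σ a₀ θ₀ u₀ Φ t φ η₁ → ∀ (A : ℝ → T3 → Fin 3 → Fin 3 → ℝ), SmoothMatrixOn (Icc 0 t) A → ∀ τ ∈ Icc 0 t, ∀ η δ : ℝ, 0 < η → 0 < δ → ∃ r₀ : ℝ, 0 < r₀ ∧ ∀ r : ℝ, 0 < r → r < r₀ → ∃ N₀ : ℕ, ∀ N : ℕ, N₀ ≤ N → Literature.MathematicalPhysics.KineticTheory.localGibbsLaw σ a₀ u₀ θ₀ N (Φ N) {z | η < |(RhsA σ Φ (fun (_ : ℕ) (y : T3) => Literature.MathematicalPhysics.KineticTheory.coneKernel r y 0) A N z τ + KfunA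 σ Φ (fun (_ : ℕ) (y : T3) => Literature.MathematicalPhysics.KineticTheory.coneKernel r y 0) A N z τ) - (RhsA σ Φ φ A N z τ + KfunA σ Φ φ A N z τ)|} ≤ ENNReal.ofReal δ

/-- **[TS] ∀ (a₀ θ₀ : (UnitAddTorus (Fin 3)) → ℝ) (u₀ : (UnitAddTorus (Fin 3)) → (EuclideanSpace ℝ (Fin 3))), Continuous a₀ → Continuous θ₀ → Continuous u₀ → (∀ x, 0 < a₀ x) → (∀ x, 0 < θ₀ x) → ∃ σ₀ : ℝ, 0 < σ₀ ∧ ∃ η₁ : ℝ, 0 < η₁ ∧ ∀ σ : ℝ, 0 < σ → σ < σ₀ → ∀ Φ : (N : ℕ) → Literature.Analysis.FluidPDE.HardSphereFlow (Literature.Analysis.FluidPDE.Torus.geometry (Fin 3)) (Literature.MathematicalPhysics.KineticTheory.hsDiameter σ N) (N + 1), ∀ t : ℝ, 0 < t → ∀ (γ C : ℝ) (φ : ℕ → (UnitAddTorus (Fin 3)) → ℝ), 0 < γ → γ ≤ 1 / 15 → ((∀ N, Literature.Analysis.FunctionSpaces.Torus.IsSmooth (φ N)) ∧ (∀ N y,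 0 ≤ φ N y) ∧ (∀ N, ∫ y, φ N y = 1) ∧ (∀ (N : ℕ) y, ((N : ℝ) + 1) ^ (-γ) ≤ Literature.Analysis.FluidPDE.Torus.euclidDist y 0 → φ N y = 0) ∧ (∀ (N : ℕ) y, φ N y ≤ C * ((N : ℝ) + 1) ^ (3 * γ)) ∧ (∀ (N : ℕ) y, ‖Literature.Analysis.FunctionSpaces.Torus.gradient (φ N) y‖ ≤ C * ((N : ℝ) + 1) ^ (4 * γ))) → let ρb := fun (χ : ℕ → (UnitAddTorus (Fin 3)) → ℝ) (N : ℕ) (z : Literature.Analysis.FluidPDE.Config (N + 1) (Fin 3) (UnitAddTorus (Fin 3))) (x : (UnitAddTorus (Fin 3))) => Literature.MathematicalPhysics.KineticTheory.empiricalDensityField z (fun y => χ N (y - x)); let mb := fun (χ : ℕ → (UnitAddTorus (Fin 3)) → ℝ) (N : ℕ) (z : Literature.Analysis.FluidPDE.Config (N + 1) (Fin 3) (UnitAddTorus (Fin 3))) (x : (UnitAddTorus (Fin 3))) => Literature.MathematicalPhysics.KineticTheory.empiricalMomentumField z (fun y => χ N (y - x)); let Eb := fun (χ : ℕ → (UnitAddTorus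 (Fin 3)) → ℝ) (N : ℕ) (z : Literature.Analysis.FluidPDE.Config (N + 1) (Fin 3) (UnitAddTorus (Fin 3))) (x : (UnitAddTorus (Fin 3))) => Literature.MathematicalPhysics.KineticTheory.empiricalEnergyField z (fun y => χ N (y - x)); let ub := fun (χ : ℕ → (UnitAddTorus (Fin 3)) → ℝ) (N : ℕ) (z : Literature.Analysis.FluidPDE.Config (N + 1) (Fin 3) (UnitAddTorus (Fin 3))) (x : (UnitAddTorus (Fin 3))) => (ρb χ N z x)⁻¹ • mb χ N z x; let θb := fun (χ : ℕ → (UnitAddTorus (Fin 3)) → ℝ) (N : ℕ) (z : Literature.Analysis.FluidPDE.Config (N + 1) (Fin 3) (UnitAddTorus (Fin 3))) (x : (UnitAddTorus (Fin 3))) => 2 / 3 * (Eb χ N z x / ρb χ N z x - ‖mb χ N z x‖ ^ 2 / (2 * ρb χ N z x ^ 2)); let pc := fun (r th : ℝ) => Literature.MathematicalPhysics.KineticTheory.hsPressure σ r th - r * th; let D := fun (χ : ℕ → (UnitAddTorus (Fin 3)) → ℝ) (N : ℕ) (z : Literature.Analysis.FluidPDE.Config (N + 1) (Fin 3) (UnitAddTorus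 (Fin 3))) (x : (UnitAddTorus (Fin 3))) (j k : Fin 3) => (∫ y, χ N (y.1 - x) * ((y.2 j - ub χ N z x j) * (y.2 k - ub χ N z x k)) ∂(Literature.Analysis.FluidPDE.empiricalMeasure z)) - (if j = k then (∑ l : Fin 3, ∫ y, χ N (y.1 - x) * (y.2 l - ub χ N z x l) ^ 2 ∂(Literature.Analysis.FluidPDE.empiricalMeasure z)) / 3 else 0); let V := fun (χ : ℕ → (UnitAddTorus (Fin 3)) → ℝ) (A : ℝ → (UnitAddTorus (Fin 3)) → Fin 3 → Fin 3 → ℝ) (N : ℕ) (z : Literature.Analysis.FluidPDE.Config (N + 1) (Fin 3) (UnitAddTorus (Fin 3))) (τ : ℝ) => (∫ s in Icc 0 τ, ∫ x, (∑ a, A s x a a) * pc (ρb χ N ((Φ N).flow s z) x) (θb χ N ((Φ N).flow s z) x)) + ∫ s in Icc 0 τ, ∫ x, 2 / 5 * (∑ a, ∑ b, D χ N ((Φ N).flow s z) x a b * A s x a b) / (ρb χ N ((Φ N).flow s z) x * θb χ N ((Φ N).flow s z) x) * pc (ρb χ N ((Φ N).flow s z) x) (θb χ N ((Φ N).flow s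 z) x); Tendsto (fun N : ℕ => Literature.MathematicalPhysics.KineticTheory.localGibbsLaw σ a₀ u₀ θ₀ N (Φ N) {z | ∃ s ∈ Icc 0 t, ∃ x : (UnitAddTorus (Fin 3)), η₁ < ρb φ N ((Φ N).flow s z) x * σ ^ 3}) atTop (𝓝 0) → ∀ (A : ℝ → (UnitAddTorus (Fin 3)) → Fin 3 → Fin 3 → ℝ), (∀ a b, Literature.Analysis.FunctionSpaces.Torus.IsSmoothSpaceTimeOn (Icc 0 t) (fun s x => A s x a b)) → ∀ τ ∈ Icc 0 t, ∀ η δ : ℝ, 0 < η → 0 < δ → ∃ r₀ : ℝ, 0 < r₀ ∧ ∀ r : ℝ, 0 < r → r < r₀ → ∃ N₀ : ℕ, ∀ N : ℕ, N₀ ≤ N → Literature.MathematicalPhysics.KineticTheory.localGibbsLaw σ a₀ u₀ θ₀ N (Φ N) {z | η < |V (fun (_ : ℕ) (y : (UnitAddTorus (Fin 3))) => Literature.MathematicalPhysics.KineticTheory.coneKernel r y 0) A N z τ - V φ A N z τ|} ≤ ENNReal.ofReal δD in route vocabulary** (only Mathlib/Literature names and `let`-telescopes; the kernel `χ` of the block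 fields is a parameter of
the `let`s so that the cone kernel and the mesoscale kernel use the same bodies). -/
def TwoScaleValueRegularityInline : Prop :=
  ∀ (a₀ θ₀ : (UnitAddTorus (Fin 3)) → ℝ) (u₀ : (UnitAddTorus (Fin 3)) → (EuclideanSpace ℝ (Fin 3))), Continuous a₀ → Continuous θ₀ → Continuous u₀ → (∀ x, 0 < a₀ x) → (∀ x, 0 < θ₀ x) → ∃ σ₀ : ℝ, 0 < σ₀ ∧ ∃ η₁ : ℝ, 0 < η₁ ∧ ∀ σ : ℝ, 0 < σ → σ < σ₀ → ∀ Φ : (N : ℕ) → Literature.Analysis.FluidPDE.HardSphereFlow (Literature.Analysis.FluidPDE.Torus.geometry (Fin 3)) (Literature.MathematicalPhysics.KineticTheory.hsDiameter σ N) (N + 1), ∀ t : ℝ, 0 < t → ∀ (γ C : ℝ) (φ : ℕ → (UnitAddTorus (Fin 3)) → ℝ), 0 < γ → γ ≤ 1 / 15 → ((∀ N, Literature.Analysis.FunctionSpaces.Torus.IsSmooth (φ N)) ∧ (∀ N y, 0 ≤ φ N y) ∧ (∀ N, ∫ y, φ N y = 1) ∧ (∀ (N : ℕ) y, ((N : ℝ)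 + 1) ^ (-γ) ≤ Literature.Analysis.FluidPDE.Torus.euclidDist y 0 → φ N y = 0) ∧ (∀ (N : ℕ) y, φ N y ≤ C * ((N : ℝ) + 1) ^ (3 * γ)) ∧ (∀ (N : ℕ) y, ‖Literature.Analysis.FunctionSpaces.Torus.gradient (φ N) y‖ ≤ C * ((N : ℝ) + 1) ^ (4 * γ))) → let ρb := fun (χ : ℕ → (UnitAddTorus (Fin 3)) → ℝ) (N : ℕ) (z : Literature.Analysis.FluidPDE.Config (N + 1) (Fin 3) (UnitAddTorus (Fin 3))) (x : (UnitAddTorus (Fin 3))) => Literature.MathematicalPhysics.KineticTheory.empiricalDensityField z (fun y => χ N (y - x)); let mb := fun (χ : ℕ → (UnitAddTorus (Fin 3)) → ℝ) (N : ℕ) (z : Literature.Analysis.FluidPDE.Config (N + 1) (Fin 3) (UnitAddTorus (Fin 3))) (x : (UnitAddTorus (Fin 3))) => Literature.MathematicalPhysics.KineticTheory.empiricalMomentumField z (fun y => χ N (y - x)); let Eb := fun (χ : ℕ → (UnitAddTorus (Fin 3)) → ℝ) (N : ℕ) (z : Literature.Analysis.FluidPDE.Config (N + 1) (Fin 3)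 (UnitAddTorus (Fin 3))) (x : (UnitAddTorus (Fin 3))) => Literature.MathematicalPhysics.KineticTheory.empiricalEnergyField z (fun y => χ N (y - x)); let ub := fun (χ : ℕ → (UnitAddTorus (Fin 3)) → ℝ) (N : ℕ) (z : Literature.Analysis.FluidPDE.Config (N + 1) (Fin 3) (UnitAddTorus (Fin 3))) (x : (UnitAddTorus (Fin 3))) => (ρb χ N z x)⁻¹ • mb χ N z x; let θb := fun (χ : ℕ → (UnitAddTorus (Fin 3)) → ℝ) (N : ℕ) (z : Literature.Analysis.FluidPDE.Config (N + 1) (Fin 3) (UnitAddTorus (Fin 3))) (x : (UnitAddTorus (Fin 3))) => 2 / 3 * (Eb χ N z x / ρb χ N z x - ‖mb χ N z x‖ ^ 2 / (2 * ρb χ N z x ^ 2)); let pc := fun (r th : ℝ) => Literature.MathematicalPhysics.KineticTheory.hsPressure σ r th - r * th; let D := fun (χ : ℕ → (UnitAddTorus (Fin 3)) → ℝ) (N : ℕ) (z : Literature.Analysis.FluidPDE.Config (N + 1) (Fin 3) (UnitAddTorus (Fin 3))) (x : (UnitAddTorus (Fin 3))) (j k : Fin 3) => (∫ y, χ N (y.1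 - x) * ((y.2 j - ub χ N z x j) * (y.2 k - ub χ N z x k)) ∂(Literature.Analysis.FluidPDE.empiricalMeasure z)) - (if j = k then (∑ l : Fin 3, ∫ y, χ N (y.1 - x) * (y.2 l - ub χ N z x l) ^ 2 ∂(Literature.Analysis.FluidPDE.empiricalMeasure z)) / 3 else 0); let V := fun (χ : ℕ → (UnitAddTorus (Fin 3)) → ℝ) (A : ℝ → (UnitAddTorus (Fin 3)) → Fin 3 → Fin 3 → ℝ) (N : ℕ) (z : Literature.Analysis.FluidPDE.Config (N + 1) (Fin 3) (UnitAddTorus (Fin 3))) (τ : ℝ) => (∫ s in Icc 0 τ, ∫ x, (∑ a, A s x a a) * pc (ρb χ N ((Φ N).flow s z) x) (θb χ N ((Φ N).flow s z) x)) + ∫ s in Icc 0 τ, ∫ x, 2 / 5 * (∑ a, ∑ b, D χ N ((Φ N).flow s z) x a b * A s x a b) / (ρb χ N ((Φ N).flow s z) x * θb χ N ((Φ N).flow s z) x) * pc (ρb χ N ((Φ N).flow s z) x) (θb χ N ((Φ N).flow s z) x); Tendsto (fun N : ℕ => Literature.MathematicalPhysics.KineticTheory.localGibbsLaw σ a₀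 u₀ θ₀ N (Φ N) {z | ∃ s ∈ Icc 0 t, ∃ x : (UnitAddTorus (Fin 3)), η₁ < ρb φ N ((Φ N).flow s z) x * σ ^ 3}) atTop (𝓝 0) → ∀ (A : ℝ → (UnitAddTorus (Fin 3)) → Fin 3 → Fin 3 → ℝ), (∀ a b, Literature.Analysis.FunctionSpaces.Torus.IsSmoothSpaceTimeOn (Icc 0 t) (fun s x => A s x a b)) → ∀ τ ∈ Icc 0 t, ∀ η δ : ℝ, 0 < η → 0 < δ → ∃ r₀ : ℝ, 0 < r₀ ∧ ∀ r : ℝ, 0 < r → r < r₀ → ∃ N₀ : ℕ, ∀ N : ℕ, N₀ ≤ N → Literature.MathematicalPhysics.KineticTheory.localGibbsLaw σ a₀ u₀ θ₀ N (Φ N) {z | η < |V (fun (_ : ℕ) (y : (UnitAddTorus (Fin 3))) => Literature.MathematicalPhysics.KineticTheory.coneKernel r y 0) A N z τ - V φ A N z τ|} ≤ ENNReal.ofReal δ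

/-- **Registered helper `twoScaleValueRegularity_iff_inline`.** The inlined route text IS the line's statement [TS] (definitional unfolding of
`NiceProfiles`, `AdmissibleKernel`, `DiluteAt`, `SmoothMatrixOn`, `RhsA`, `KfunA`, `trW`, `kinWA`, `Dst`, `pkin`, `pcoll`, `rhoB`, `mB`, `EB`, `uB`, `thetaB`). -/
theorem twoScaleValueRegularity_iff_inline : TwoScaleValueRegularityInline ↔ TwoScaleValueRegularity := by
  constructor
  · intro h a₀ θ₀ u₀ hP
    obtain ⟨ha, hθ, hu, ha0, hθ0⟩ := hP
    exact h a₀ θ₀ u₀ ha hθ hu ha0 hθ0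
  · intro h a₀ θ₀ u₀ ha hθ hu ha0 hθ0
    exact h a₀ θ₀ u₀ ⟨ha, hθ, hu, ha0, hθ0⟩

end

end Summit.AtomisticToContinuum.HydrodynamicLimit.Theorems.HemisphereAffineSlaving
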